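import Summits.BirchSwinnertonDyer.Rank1Residual.GaloisImage.NonsplitMultiplicativeUnramifiedSelmer
import Literature.NumberTheory.EllipticCurves.LocalKummerMap
import Literature.NumberTheory.EllipticCurves.LocalKummerIsotropyTransport
import HarnessLib

/-!
# KIND (vi): a GOOD curve facing a NON-SPLIT multiplicative `p`-congruent partner — the local
# Kummer conditions correspond (cell `b2b-bsdres`, team n1011, row T-NSK2; seat p04 GEN 10;
# skeleton `cells/n1011/skel/T-NSK2.md`)

HONEST FRAMING (cell `b2b-bsdres`, run/shared/lean/b2b/bsd-rank1-residual/, verbatim in every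
file): the goal of the cell is to DELETE the COMBINATION-SHAPED residual classes of the
Birch–Swinnerton-Dyer formula for ALL analytic-rank `≤ 1` elliptic curves over `ℚ` — "full BSD
formula for every rank `≤ 1` curve in class `C`" assembled STRICTLY from published theorems — so
that the rank-`≤ 1` remainder becomes exactly the CONSTRUCTION-SHAPED classes, which are TYPED
(missing-input `Prop`s), NOT attempted. This is not "finishing BSD". Team n1011 (N10 / N11, the
additive block X4 ∧ `p = 3`): research route on the CONSTRUCTION-SHAPED class X4; no claim beyond
the stated classes; nothing is booked; no mark / label / count is changed by this file. Theorems
only (no definition, no new named fact, no `sorry`); general (any number field, any odd prime `p`)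
and cell-independent. CONDITIONAL on the registered named fact
`Silverman1994_thmV53_corV54_tateUniformisation` (`hU2`, the cell's A41). Closes NO class by
itself: it frees one more kind of place in a per-row visibility certificate whose other inputs are
EVIDENCE until kernel-certified.

## What

Kind (iv′) (`NonsplitMultiplicativeUnramifiedSelmer.lean`) compares the local Selmer conditions of
`p`-congruent curves `E`, `E′` (`θ : E′[p] ≃ E[p]`) at a place `v ∤ p` where `E` is NON-SPLIT
multiplicative and `E′` is GOOD: `θ_* 𝓢_v(E′) ≤ 𝓢_v(E)`. This file proves the CONVERSE
configuration, KIND (vi): `E` GOOD at `v ∤ p`, `E′` NON-SPLIT multiplicative (`γ(E′) = -c₄/c₆` a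
non-square in `K_v`), `p` odd ⟹ `θ_* 𝓢_v(E′) ≤ 𝓢_v(E)`
(`h1Equiv_mem_selmerLocalKer_of_hasGoodReductionAt_of_nonsplit`,
`relIndex_map_selmerLocalKer_eq_one_of_hasGoodReductionAt_of_nonsplit`: `ι_v(θ) = 1`), with NO
hypothesis on `E(K_v)[p]`, `E′(K_v)[p]`, `ord_v Δ_{E′}` or `c_v(E′)`. Route planner 1's census
(ROUTE-1 §41.3, FAIL-other anatomy "good/nonsplit"): 58 N11 rows whose only obstruction was such
a place (`#E′(ℚ_w)[3] = 3` there, i.e. `N w ≡ -1 (mod 3)`; 25 of them at `w = 2`).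

## Proof (local, in the `kummerLocalConditionAt` currency; no valuation theory, `w = 2` included)

* `map_kummerLocalConditionAt_le_of_hasGoodReductionAt_of_nonsplit`: for ANY continuous
  `Γ_{K_v}`-intertwining map `f : E[p](K̄)|_{Γ_{K_v}} → E′[p](K̄)|_{Γ_{K_v}}`, `H¹(f)` maps
  `𝓛_v(E)` into `𝓛_v(E′)` — a class of `𝓛_v(E)` is a local Kummer class `κ(Q)`
  (`exists_eq_localKummerClass_of_mem`) whose cocycle `σ ↦ σQ - Q` vanishes on `I_𝔐` at GOOD
  `v ∤ p` (`smul_localPoints_eq_of_mem_inertia_holds`, Silverman X.4.4's reduction step), so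
  `f ∘ κ(Q)` dies in `H¹(K_v, E′)` by T-NSK's `oneCocycleClass_eq_zero_of_nonsplit`;
* `map_injective_of_leftInverse`: `H¹(f)` is injective when `f` has an intertwining left inverse;
* `natCard_ker_nsmul_eq_natCard_fixed` (Galois descent: `#E(K_v)[p] = #E[p](K̄)^{Γ_{K_v}}`,
  `mem_range_toGeomPoints_iff` + the equivariant torsion transfer `torsionTransferEquiv`) and
  `natCard_kummerLocalConditionAt_eq_of_congr`: `#𝓛_v(E) = #𝓛_v(E′)`
  (`natCard_kummerLocalConditionAt_adicCompletion`: `#𝓛_v = #E(K_v)[p] · #(𝓞_v/p)`);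
* hence `H¹(θ⁻¹|_{Γ_{K_v}})` maps `𝓛_v(E)` ONTO `𝓛_v(E′)`, so `H¹(θ|_{Γ_{K_v}})(𝓛_v(E′)) ⊆ 𝓛_v(E)`;
  with `𝓢_v = res_v⁻¹ 𝓛_v` (`comap_res_kummerLocalConditionAt`), `res_v ∘ θ_* = H¹(θ|) ∘ res_v`
  (`galoisCohomology.res_map_one`) and `θ_* = H¹(θ)` on classes of cocycles.

## References

* [MilneADT2006] J. S. Milne, *Arithmetic Duality Theorems*, 2nd ed., Ch. I Prop. 3.8, Lemma 3.3.
* [SilvermanAEC2009] J. H. Silverman, *AEC*, 2nd ed., VIII.§1–§2, X.§4 (Thm. 4.2(b), Cor. 4.4).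
* [CremonaMazur2000] J. E. Cremona, B. Mazur, Experiment. Math. 9 (2000), §3.
* [SilvermanATAEC1994] J. H. Silverman, *ATAEC*, Ch. V Lemma 5.2 (c), Thm. 5.3, Cor. 5.4.
-/

noncomputable section

open scoped Classical Topology Pointwise ContRepresentation
open Field NumberField IsDedekindDomain WeierstrassCurve
open Literature.NumberTheory.EllipticCurves Literature.NumberTheory.GaloisRepresentations

namespace Summit.BirchSwinnertonDyer.Rank1Residual.GaloisImage

namespace NonsplitKummer

section Local

variable {K : Type} [Field K] [NumberField K] (W W' : WeierstrassCurve K) [W.IsElliptic]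
  [W'.IsElliptic] (v : HeightOneSpectrum (𝓞 K)) {p : ℕ} [hpr : Fact p.Prime]

/-- **Transported Kummer classes of a GOOD curve die for a NON-SPLIT multiplicative curve.** Let
`v ∤ p` (`p` odd) be a place where `E = W` has good reduction and `E′ = W′` has multiplicative
reduction with `γ(E′) = -c₄/c₆` a non-square in `K_v`, and let
`f : E[p](K̄)|_{Γ_{K_v}} → E′[p](K̄)|_{Γ_{K_v}}` be ANY continuous `Γ_{K_v}`-equivariant map of the
restricted torsion modules.  Then `H¹(f)` maps the local Kummer condition `𝓛_v(E)` into `𝓛_v(E′)`: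
a class of `𝓛_v(E)` is the local Kummer class `κ(Q)`, `p Q ∈ E(K_v)` (`exists_eq_localKummerClass_of_mem`),
whose cocycle `σ ↦ σQ - Q` VANISHES on the inertia group (`smul_localPoints_eq_of_mem_inertia_holds`,
good `v ∤ p`); so `f ∘ κ(Q)` is a continuous crossed homomorphism `Γ_{K_v} → E′(K̄_v)` with
`p`-torsion values vanishing on `I_𝔐`, hence principal by `oneCocycleClass_eq_zero_of_nonsplit`
(T-NSK FILE 2; conditional on `hU2`). [cite: MilneADT2006, Ch. I Prop. 3.8]
[cite: SilvermanAEC2009, X.§4 (proof of Thm. 4.2(b))] -/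
theorem map_kummerLocalConditionAt_le_of_hasGoodReductionAt_of_nonsplit
    (hU2 : Silverman1994_thmV53_corV54_tateUniformisation.{0})
    (hW : W.HasGoodReductionAt v) (hW' : W'.HasMultiplicativeReductionAt v)
    (hγ' : ¬ IsSquare (algebraMap K (v.adicCompletion K) (-(W'.c₄ / W'.c₆))))
    (hp2 : p ≠ 2) (hv : (p : 𝓞 K) ∉ v.asIdeal)
    (f : (GaloisRep.restrictField (v.adicCompletion K)
        (W.torsionGaloisModule (p : ℤ))).toContRepresentation →ⁱL
      (GaloisRep.restrictField (v.adicCompletion K)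
        (W'.torsionGaloisModule (p : ℤ))).toContRepresentation) :
    (W.kummerLocalConditionAt (p : ℤ) (v.adicCompletion K)).map (galoisCohomology.map f 1) ≤
      W'.kummerLocalConditionAt (p : ℤ) (v.adicCompletion K) := by
  have hpp : p.Prime := hpr.out
  have hn : ((p : ℕ) : ℤ) ≠ 0 := by exact_mod_cast hpp.ne_zero
  have hn' : (((p : ℕ) : ℤ) : 𝓞 K) ∉ v.asIdeal := by rwa [Int.cast_natCast]
  haveI : CharZero (v.adicCompletion K) := charZero_adicCompletion v
  rintro _ ⟨x, hx, rfl⟩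
  obtain ⟨Q, hQ, rfl⟩ := W.exists_eq_localKummerClass_of_mem (p : ℤ) hn hx
  obtain ⟨𝔐, h𝔐⟩ := v.localPrimesAbove_nonempty
  rw [WeierstrassCurve.localKummerClass, galoisCohomology.map_one_oneCocycleClass,
    W'.mem_kummerLocalConditionAt_iff, W'.map_torsionPointsMapIntertwining_oneCocycleClass]
  refine oneCocycleClass_eq_zero_of_nonsplit W' v hU2 hW' hγ' (hpp.odd_of_ne_two hp2) h𝔐 _ 0
    (smul_zero _) (fun τ hτ ↦ ?_) (fun σ ↦ ?_)
  · -- the cocycle vanishes on inertia: `τ Q = Q` at good `v ∤ p`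
    have hfixQ : τ • Q = Q := by
      refine W.smul_localPoints_eq_of_mem_inertia_holds v (fun h ↦ h hW) hn' h𝔐 hτ ?_
      rw [zsmul_sub, ← W.smul_zsmul_localPoints ((p : ℕ) : ℤ) τ Q, hQ τ, sub_self]
    have hκ0 : (W.localKummerCocycle (p : ℤ) hn Q hQ).1 τ = 0 := by
      apply Subtype.ext
      apply pointsMapOfEmb_injective W (closureEmb (K := K) (v.adicCompletion K))
      change pointsMap W (v.adicCompletion K) ((W.localKummerCocycle (p : ℤ) hn Q hQ).1 τ :
        geomTorsion W (p : ℤ)) = pointsMap W (v.adicCompletion K) ((0 : geomTorsion W (p : ℤ)) :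
        geomPoints W)
      rw [W.pointsMap_localKummerCocycle_apply, hfixQ, sub_self, ZeroMemClass.coe_zero, map_zero]
    have e : (ContinuousMonoidHom.id (absoluteGaloisGroup (v.adicCompletion K)))
        ((ContinuousMonoidHom.id (absoluteGaloisGroup (v.adicCompletion K))) τ) = τ := rfl
    rw [smul_zero, sub_zero, contOneCocycles.pullback_apply, contOneCocycles.pullback_apply, e, hκ0,
      map_zero, map_zero]
  · -- the cocycle takes `p`-torsion values
    have hp0 : ((p : ℕ) : ℤ) • (W.localKummerCocycle (p : ℤ) hn Q hQ).1 σ = 0 :=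
      Subtype.ext ((Submodule.mem_torsionBy_iff _ _).mp ((W.localKummerCocycle (p : ℤ) hn Q hQ).1 σ).2)
    have e : (ContinuousMonoidHom.id (absoluteGaloisGroup (v.adicCompletion K)))
        ((ContinuousMonoidHom.id (absoluteGaloisGroup (v.adicCompletion K))) σ) = σ := rfl
    rw [contOneCocycles.pullback_apply, contOneCocycles.pullback_apply, e, ← map_zsmul, ← map_zsmul,
      hp0, map_zero, map_zero]

omit [NumberField K] [W.IsElliptic] [W'.IsElliptic] hpr in
/-- `H¹(f)` is injective on `H¹(Γ_E, E[p](K̄)|_{Γ_E})` when the intertwining map `f` has an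
intertwining left inverse `g` (`[f ∘ ψ] = 0 ⟹ f ∘ ψ = ∂a ⟹ ψ = g ∘ f ∘ ψ = ∂(g a)`). [folklore] -/
theorem map_injective_of_leftInverse {E : Type} [Field E] [Algebra K E]
    (f : (GaloisRep.restrictField E (W.torsionGaloisModule (p : ℤ))).toContRepresentation →ⁱL
      (GaloisRep.restrictField E (W'.torsionGaloisModule (p : ℤ))).toContRepresentation)
    (g : (GaloisRep.restrictField E (W'.torsionGaloisModule (p : ℤ))).toContRepresentation →ⁱL
      (GaloisRep.restrictField E (W.torsionGaloisModule (p : ℤ))).toContRepresentation)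
    (hgf : ∀ x, g (f x) = x) : Function.Injective (galoisCohomology.map f 1) := by
  refine (injective_iff_map_eq_zero _).mpr fun c hc ↦ ?_
  obtain ⟨ψ, rfl⟩ := oneCocycleClass_surjective _ c
  rw [galoisCohomology.map_one_oneCocycleClass] at hc
  obtain ⟨a, ha⟩ := (oneCocycleClass_eq_zero_iff _ _).mp hc
  refine (oneCocycleClass_eq_zero_iff _ _).mpr ⟨g a, fun σ ↦ ?_⟩
  have h := congrArg g (ha σ)
  rw [contOneCocycles.pullback_apply] at h
  change g (f (ψ.1 σ)) = g (absGaloisRestrict K E σ • a - a) at h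
  have hga : g (absGaloisRestrict K E σ • a) = absGaloisRestrict K E σ • g a :=
    ContIntertwiningMap.isIntertwining g σ a
  rw [hgf, map_sub, hga] at h
  exact h

/-- **Galois descent for the `p`-torsion of the `K_v`-points**: `#E(K_v)[p]` equals the number of
`Γ_{K_v}`-fixed points of `E[p](K̄)` (`Γ_{K_v}` acting through the restriction to `K̄`): the
injection `E(K_v) ↪ E(K̄_v)` has image the fixed points (`mem_range_toGeomPoints_iff`, `K_v`
perfect), and the torsion transfer `E[p](K̄) ≃ (E⁄K_v)[p](K̄_v)` is `Γ_{K_v}`-equivariant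
(`torsionTransferEquiv_smul`). Silverman, *AEC*, VIII.§1. [folklore] -/
theorem natCard_ker_nsmul_eq_natCard_fixed {E : Type} [Field E] [Algebra K E] [CharZero E] :
    Nat.card (nsmulAddMonoidHom p : (W.baseChange E).toAffine.Point →+ _).ker =
      Nat.card {T : geomTorsion W (p : ℤ) //
        ∀ σ : absoluteGaloisGroup E, absGaloisRestrict K E σ • T = T} := by
  have hn : ((p : ℕ) : ℤ) ≠ 0 := by exact_mod_cast hpr.out.ne_zero
  haveI : PerfectField E := PerfectField.ofCharZero
  have hmem : ∀ P : (nsmulAddMonoidHom p : (W.baseChange E).toAffine.Point →+ _).ker,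
      toGeomPoints (W.baseChange E) (P : (W.baseChange E).toAffine.Point) ∈
        geomTorsion (W.baseChange E) (p : ℤ) := by
    intro P
    rw [mem_geomTorsion_iff, ← map_zsmul, natCast_zsmul, ← nsmulAddMonoidHom_apply,
      (AddMonoidHom.mem_ker).mp P.2, map_zero]
  have hfix : ∀ (P : (nsmulAddMonoidHom p : (W.baseChange E).toAffine.Point →+ _).ker)
      (σ : absoluteGaloisGroup E),
      absGaloisRestrict K E σ • (W.torsionTransferEquiv (E := E) hn).symm
          ⟨toGeomPoints (W.baseChange E) (P : (W.baseChange E).toAffine.Point), hmem P⟩ =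
        (W.torsionTransferEquiv (E := E) hn).symm
          ⟨toGeomPoints (W.baseChange E) (P : (W.baseChange E).toAffine.Point), hmem P⟩ := by
    intro P σ
    rw [← torsionTransferEquiv_symm_smul]
    congr 1
    apply Subtype.ext
    rw [Literature.NumberTheory.EllipticCurves.AddSubgroup.torsionBy.coe_smul]
    exact smul_toGeomPoints (W.baseChange E) σ P
  let φ : (nsmulAddMonoidHom p : (W.baseChange E).toAffine.Point →+ _).ker →
      {T : geomTorsion W (p : ℤ) // ∀ σ : absoluteGaloisGroup E, absGaloisRestrict K E σ • T = T} :=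
    fun P ↦ ⟨(W.torsionTransferEquiv (E := E) hn).symm
      ⟨toGeomPoints (W.baseChange E) (P : (W.baseChange E).toAffine.Point), hmem P⟩, hfix P⟩
  refine Nat.card_eq_of_bijective φ ⟨fun P P' h ↦ ?_, fun T ↦ ?_⟩
  · have h1 := congrArg (fun T : {T : geomTorsion W (p : ℤ) //
        ∀ σ : absoluteGaloisGroup E, absGaloisRestrict K E σ • T = T} ↦
      ((W.torsionTransferEquiv (E := E) hn T.1 : geomTorsion (W.baseChange E) (p : ℤ)) :
        geomPoints (W.baseChange E))) h
    simp only [φ, AddEquiv.apply_symm_apply] at h1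
    exact Subtype.ext (toGeomPoints_injective (W.baseChange E) h1)
  · -- surjectivity: a fixed torsion point comes from `E(K_v)`
    have hTfix : ((W.torsionTransferEquiv (E := E) hn T.1 : geomTorsion (W.baseChange E) (p : ℤ)) :
        geomPoints (W.baseChange E)) ∈
          MulAction.fixedPoints (absoluteGaloisGroup E) (geomPoints (W.baseChange E)) := by
      intro σ
      rw [← Literature.NumberTheory.EllipticCurves.AddSubgroup.torsionBy.coe_smul,
        ← torsionTransferEquiv_smul, T.2 σ]
    obtain ⟨P, hP⟩ := (mem_range_toGeomPoints_iff (W.baseChange E) _).mpr hTfix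
    have hPker : P ∈ (nsmulAddMonoidHom p : (W.baseChange E).toAffine.Point →+ _).ker := by
      rw [AddMonoidHom.mem_ker, nsmulAddMonoidHom_apply]
      apply toGeomPoints_injective (W.baseChange E)
      rw [map_nsmul, hP, map_zero, ← natCast_zsmul]
      exact (mem_geomTorsion_iff _ _ _).mp (W.torsionTransferEquiv (E := E) hn T.1).2
    refine ⟨⟨P, hPker⟩, Subtype.ext ?_⟩
    change (W.torsionTransferEquiv (E := E) hn).symm _ = T.1
    apply (W.torsionTransferEquiv (E := E) hn).injective
    rw [AddEquiv.apply_symm_apply]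
    exact Subtype.ext hP

/-- **`#𝓛_v(E) = #𝓛_v(E′)` for `p`-congruent curves** (`θ : E′[p] ≃ E[p]` `Γ_K`-equivariant): both
local Kummer conditions have order `#E(K_v)[p] · #(𝓞_v/p)`
(`natCard_kummerLocalConditionAt_adicCompletion`), and `#E(K_v)[p] = #E′(K_v)[p]` by Galois
descent (`natCard_ker_nsmul_eq_natCard_fixed`) since `θ` matches the `Γ_{K_v}`-fixed points of
`E′[p]` and `E[p]`. [cite: MilneADT2006, I Lemma 3.3] -/
theorem natCard_kummerLocalConditionAt_eq_of_congr
    (θ : geomTorsion W' (p : ℤ) ≃+ geomTorsion W (p : ℤ))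
    (hθ : ∀ (σ : absoluteGaloisGroup K) (P : geomTorsion W' (p : ℤ)), θ (σ • P) = σ • θ P) :
    Nat.card (W.kummerLocalConditionAt (p : ℤ) (v.adicCompletion K)) =
      Nat.card (W'.kummerLocalConditionAt (p : ℤ) (v.adicCompletion K)) := by
  have hpp : p.Prime := hpr.out
  haveI : CharZero (v.adicCompletion K) := charZero_adicCompletion v
  rw [W.natCard_kummerLocalConditionAt_adicCompletion v hpp.ne_zero,
    W'.natCard_kummerLocalConditionAt_adicCompletion v hpp.ne_zero,
    natCard_ker_nsmul_eq_natCard_fixed W, natCard_ker_nsmul_eq_natCard_fixed W']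
  congr 1
  refine Nat.card_congr (Equiv.subtypeEquiv θ.symm.toEquiv fun T ↦ ?_)
  change (∀ σ, _ • T = T) ↔ ∀ σ, _ • θ.symm T = θ.symm T
  refine forall_congr' fun σ ↦ ⟨fun h ↦ ?_, fun h ↦ ?_⟩
  · apply θ.injective
    rw [hθ, AddEquiv.apply_symm_apply, h]
  · have h' := congrArg θ h
    rwa [hθ, AddEquiv.apply_symm_apply] at h'

/-! ### Kind (vi) -/

/-- **KIND (vi): the local Kummer conditions of two `p`-congruent curves agree at a place where
`E` has GOOD reduction and `E′` is NON-SPLIT multiplicative, `v ∤ p`, `p` odd** — the converse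
companion of kind (iv′) (`h1Equiv_mem_selmerLocalKer_of_nonsplit_of_hasGoodReductionAt`):
`θ_* 𝓢_v(E′) ≤ 𝓢_v(E)` for a `Γ_K`-isomorphism `θ : E′[p] ≃ E[p]`.  Proof (local, in the
`kummerLocalConditionAt` currency, no valuation theory): with `f′ = θ⁻¹|_{Γ_{K_v}}`,
`H¹(f′)` maps `𝓛_v(E)` INTO `𝓛_v(E′)`
(`map_kummerLocalConditionAt_le_of_hasGoodReductionAt_of_nonsplit`), injectively
(`map_injective_of_leftInverse`), and the two finite groups have the same order
(`natCard_kummerLocalConditionAt_eq_of_congr`); hence `H¹(f′)(𝓛_v(E)) = 𝓛_v(E′)`, i.e.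
`H¹(θ|_{Γ_{K_v}})(𝓛_v(E′)) ⊆ 𝓛_v(E)`, and `𝓢 = res⁻¹ 𝓛` (`comap_res_kummerLocalConditionAt`) with
`res ∘ θ_* = H¹(θ|_{Γ_{K_v}}) ∘ res` (`galoisCohomology.res_map_one`). No hypothesis on
`E(K_v)[p]`, `E′(K_v)[p]`, `ord_v Δ_{E′}` or `c_v`. Conditional on `hU2`.
[cite: MilneADT2006, Ch. I Prop. 3.8] [cite: CremonaMazur2000, §3]
[cite: SilvermanAEC2009, X.§4 (proof of Thm. 4.2(b))] -/
theorem h1Equiv_mem_selmerLocalKer_of_hasGoodReductionAt_of_nonsplit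
    (hU2 : Silverman1994_thmV53_corV54_tateUniformisation.{0}) (hp2 : p ≠ 2)
    (θ : geomTorsion W' (p : ℤ) ≃+ geomTorsion W (p : ℤ))
    (hθ : ∀ (σ : absoluteGaloisGroup K) (P : geomTorsion W' (p : ℤ)), θ (σ • P) = σ • θ P)
    (hW : W.HasGoodReductionAt v) (hW' : W'.HasMultiplicativeReductionAt v)
    (hγ' : ¬ IsSquare (algebraMap K (v.adicCompletion K) (-(W'.c₄ / W'.c₆))))
    (hv : (p : 𝓞 K) ∉ v.asIdeal)
    {c : galH1Torsion W' (p : ℤ)} (hc : c ∈ selmerLocalKer W' (v.adicCompletion K) (p : ℤ)) :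
    h1Equiv θ hθ c ∈ selmerLocalKer W (v.adicCompletion K) (p : ℤ) := by
  have hpp : p.Prime := hpr.out
  haveI : CharZero (v.adicCompletion K) := charZero_adicCompletion v
  have hθ' : ∀ (σ : absoluteGaloisGroup K) (P : geomTorsion W (p : ℤ)),
      θ.symm (σ • P) = σ • θ.symm P := fun σ P ↦ by
    apply θ.injective
    rw [AddEquiv.apply_symm_apply, hθ, AddEquiv.apply_symm_apply]
  -- the intertwining maps `θ`, `θ⁻¹` and their restrictions to `Γ_{K_v}`
  let fθ : (W'.torsionGaloisModule (p : ℤ)).toContRepresentation →ⁱL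
      (W.torsionGaloisModule (p : ℤ)).toContRepresentation :=
    { toContinuousLinearMap := ⟨θ.toAddMonoidHom.toIntLinearMap, continuous_of_discreteTopology⟩
      isIntertwining' := fun σ ↦ ContinuousLinearMap.ext fun P ↦ hθ σ P }
  let gθ : (W.torsionGaloisModule (p : ℤ)).toContRepresentation →ⁱL
      (W'.torsionGaloisModule (p : ℤ)).toContRepresentation :=
    { toContinuousLinearMap := ⟨θ.symm.toAddMonoidHom.toIntLinearMap,
        continuous_of_discreteTopology⟩
      isIntertwining' := fun σ ↦ ContinuousLinearMap.ext fun P ↦ hθ' σ P }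
  set f := fθ.restrictField (v.adicCompletion K) with hf
  set g := gθ.restrictField (v.adicCompletion K) with hg
  have hfg : ∀ x, f (g x) = x := fun x ↦ θ.apply_symm_apply x
  have hgf : ∀ x, g (f x) = x := fun x ↦ θ.symm_apply_apply x
  -- `H¹(g)` maps `𝓛_v(E)` injectively into `𝓛_v(E′)`, a group of the same finite order: onto
  have hle := map_kummerLocalConditionAt_le_of_hasGoodReductionAt_of_nonsplit W W' v hU2 hW hW' hγ'
    hp2 hv g
  have hinj := map_injective_of_leftInverse W W' g f hfg
  haveI hfin : Finite (W'.kummerLocalConditionAt (p : ℤ) (v.adicCompletion K)) :=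
    W'.finite_kummerLocalConditionAt_adicCompletion v hpp.ne_zero
  haveI hfin' : Finite (W.kummerLocalConditionAt (p : ℤ) (v.adicCompletion K)) :=
    W.finite_kummerLocalConditionAt_adicCompletion v hpp.ne_zero
  let ψ : W.kummerLocalConditionAt (p : ℤ) (v.adicCompletion K) →
      W'.kummerLocalConditionAt (p : ℤ) (v.adicCompletion K) :=
    fun x ↦ ⟨galoisCohomology.map g 1 x, hle ⟨x, x.2, rfl⟩⟩
  have hψinj : Function.Injective ψ := fun x y h ↦
    Subtype.ext (hinj (congrArg Subtype.val h))
  have hψsurj : Function.Surjective ψ :=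
    (Function.Injective.bijective_of_nat_card_le hψinj
      (le_of_eq (natCard_kummerLocalConditionAt_eq_of_congr W W' v θ hθ).symm)).2
  -- the class `res_v c ∈ 𝓛_v(E′)` is `H¹(g) x` for some `x ∈ 𝓛_v(E)`; then `H¹(f)(res_v c) = x`
  have hres : galoisCohomology.res (W'.torsionGaloisModule (p : ℤ)) (v.adicCompletion K) 1 c ∈
      W'.kummerLocalConditionAt (p : ℤ) (v.adicCompletion K) := by
    rw [← comap_res_kummerLocalConditionAt] at hc
    exact hc
  obtain ⟨x, hx⟩ := hψsurj ⟨_, hres⟩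
  have hx' : galoisCohomology.map g 1 x =
      galoisCohomology.res (W'.torsionGaloisModule (p : ℤ)) (v.adicCompletion K) 1 c :=
    congrArg Subtype.val hx
  have hfx : galoisCohomology.map f 1
      (galoisCohomology.res (W'.torsionGaloisModule (p : ℤ)) (v.adicCompletion K) 1 c) = x := by
    rw [← hx']
    obtain ⟨ξ, hξ⟩ := oneCocycleClass_surjective _
      (x : galoisCohomology (GaloisRep.restrictField (v.adicCompletion K)
        (W.torsionGaloisModule (p : ℤ))) 1)
    rw [← hξ, galoisCohomology.map_one_oneCocycleClass, galoisCohomology.map_one_oneCocycleClass]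
    exact congrArg (oneCocycleClass _) (Subtype.ext (ContinuousMap.ext fun σ ↦ hfg (ξ.1 σ)))
  -- `res_v (θ_* c) = H¹(f) (res_v c)` and `𝓢_v(E) = res_v⁻¹ 𝓛_v(E)`
  have hmapθ : galoisCohomology.map fθ 1 c = h1Equiv θ hθ c := by
    obtain ⟨φ, rfl⟩ :=
      oneCocycleClass_surjective (discreteTopRep (absoluteGaloisGroup K) (geomTorsion W' (p : ℤ))) c
    rw [h1Equiv_oneCocycleClass]
    exact (galoisCohomology.map_one_oneCocycleClass fθ φ).trans
      (congrArg (oneCocycleClass _) (Subtype.ext (ContinuousMap.ext fun σ ↦ rfl)))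
  have hgoal : galoisCohomology.res (W.torsionGaloisModule (p : ℤ)) (v.adicCompletion K) 1
      (h1Equiv θ hθ c) ∈ W.kummerLocalConditionAt (p : ℤ) (v.adicCompletion K) := by
    rw [← hmapθ, galoisCohomology.res_map_one, ← hf, hfx]
    exact x.2
  have key : h1Equiv θ hθ c ∈ (W.kummerLocalConditionAt (p : ℤ) (v.adicCompletion K)).comap
      (galoisCohomology.res (W.torsionGaloisModule (p : ℤ)) (v.adicCompletion K) 1) := hgoal
  rwa [comap_res_kummerLocalConditionAt] at key

/-- **`ι_v(θ) = 1` at a kind-(vi) place** (`E` good, `E′` non-split multiplicative, `v ∤ p`, `p`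
odd): the comparison index of `CongruenceVisibilityComparison.lean` is `1`. Conditional on `hU2`.
[cite: MilneADT2006, Ch. I Prop. 3.8] [cite: CremonaMazur2000, §3] -/
theorem relIndex_map_selmerLocalKer_eq_one_of_hasGoodReductionAt_of_nonsplit
    (hU2 : Silverman1994_thmV53_corV54_tateUniformisation.{0}) (hp2 : p ≠ 2)
    (θ : geomTorsion W' (p : ℤ) ≃+ geomTorsion W (p : ℤ))
    (hθ : ∀ (σ : absoluteGaloisGroup K) (P : geomTorsion W' (p : ℤ)), θ (σ • P) = σ • θ P)
    (hW : W.HasGoodReductionAt v) (hW' : W'.HasMultiplicativeReductionAt v)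
    (hγ' : ¬ IsSquare (algebraMap K (v.adicCompletion K) (-(W'.c₄ / W'.c₆))))
    (hv : (p : 𝓞 K) ∉ v.asIdeal) :
    (selmerLocalKer W (v.adicCompletion K) (p : ℤ)).relIndex
        ((selmerLocalKer W' (v.adicCompletion K) (p : ℤ)).map (h1Equiv θ hθ).toAddMonoidHom) = 1 :=
  (relIndex_map_selmerLocalKer_eq_one_iff W W' θ hθ).mpr fun _ hc ↦
    h1Equiv_mem_selmerLocalKer_of_hasGoodReductionAt_of_nonsplit W W' v hU2 hp2 θ hθ hW hW' hγ' hv hc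

end Local

end NonsplitKummer

end Summit.BirchSwinnertonDyer.Rank1Residual.GaloisImage

end
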